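import Mathlib
import HarnessLib
import Summits.PneNP.PneNP.Theorems.AeaCutRectanglesFixedCutFooling

/-!
# Route AeaCutRectangles — crux `FoolingMeasure` (stmt-PneNP-19727): A FOOLING MEASURE FOR EVERY NEAR-BALANCED CUT
# (the rung between the fixed-cut rung `∃ B` and the crux `∃ μ ∀ B`: here `∀ B ∃ μ`)

The BC5 rung `AeaCutRectanglesFixedCutFooling.foolingMeasure_fixedCut` (p541284) gives, for every `C` and
infinitely many `n`, a probability measure on loopless non-3-colourable edge sets and ONE balanced cut `B` all of
whose cut rectangles inside NON-3-COL are light.  This file climbs one quantifier: for every `C`, for infinitely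
many `n`, for EVERY cut `B` in the widest window X1 allows (`n/4 ≤ |B| ≤ 3n/4`, i.e. `ε = 1/4`), there is such a
measure `μ_B` (depending on `B`):

* `exists_good_cut` — in the Toft unit system `𝒯_L` (vertices `Fin 10 × Fin L`) EVERY size `b ∈ [2L, 8L]` is
  realised by a cut `core L ∪ S` (`core` = the blocks `b', c'`; `S` inside the six free blocks) that splits ALL
  `L²` units (`unit_split_of_subset_free`), so the transversal engine bounds every cut rectangle over it by
  `(1/2)^{L²}` (`toft_rect_bound`);
* `exists_equiv_map_eq` — any cut of `Fin 10 × Fin L` is carried onto any equinumerous cut of `Fin (10L)` by a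
  vertex bijection; `transport` (ToftFooling) moves the fooling package along it;
* `foolingMeasure_everyCut` / `foolingMeasure_forall_cut_exists_measure` — **X1 with `∃ μ ∀ B` weakened to
  `∀ B ∃ μ`**, all other clauses and the bound `2^{-(n/2)·log₂ n - C·n}` letter for letter, `ε = 1/4`.

(Imports `AeaCutRectanglesFixedCutFooling` for the exponent arithmetic `exponent_le`, `seven_mul_le_two_pow`; that module is in the
route cone — theses-cone warning acknowledged, reuse is mandated by dedup.landed.)

So the ENTIRE remaining content of X1 is UNIFORMITY of the measure in the cut (one `μ` for all near-balanced
`B` at once) — the SPREAD / duty-construction problem of `Cruxes/FoolingMeasure/Lines/duty.lean`; adaptivity of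
the cut per se costs nothing.

HONEST FRAMING: elementary finite combinatorics on the Toft system already in the tree; FRONTIER material for a
rung of Fagin's complement ladder (NON-3-COL vs ESO(∀∃∀)); nothing here bears on P vs NP.
-/

set_option linter.dupNamespace false -- `Summit.PneNP.PneNP.…`: summit = sub-problem name (D-0017 single-conjunct layout)

namespace Summit.PneNP.PneNP.Theorems.AeaCutRectanglesEveryCutFooling

open Finset
open Summit.PneNP.PneNP.Theorems.AeaCutRectanglesTransversalEngine
open Summit.PneNP.PneNP.Theorems.AeaCutRectanglesFixedCutFooling

/-! ### Good cuts of every size in the Toft system -/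

/-- The CORE of a good cut: the blocks `3` (`b'`) and `7` (`c'`), i.e. the inside ends of the units. -/
def core (L : ℕ) : Finset (Vx L) := univ.filter fun v => v.1 = 3 ∨ v.1 = 7

/-- The FREE vertices: blocks `0, 1, 4, 5, 8, 9` (no unit edge ends there). -/
def free (L : ℕ) : Finset (Vx L) :=
  univ.filter fun v => v.1 = 0 ∨ v.1 = 1 ∨ v.1 = 4 ∨ v.1 = 5 ∨ v.1 = 8 ∨ v.1 = 9

/-- `|core L| = 2L`. -/
theorem core_card (L : ℕ) : (core L).card = 2 * L := by
  have h : core L = (univ.filter fun k : Fin 10 => k = 3 ∨ k = 7) ×ˢ (univ : Finset (Fin L)) := by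
    ext ⟨k, i⟩
    simp [core]
  have h2 : (univ.filter fun k : Fin 10 => k = 3 ∨ k = 7).card = 2 := by decide
  rw [h, card_product, h2, card_univ, Fintype.card_fin]

/-- `|free L| = 6L`. -/
theorem free_card (L : ℕ) : (free L).card = 6 * L := by
  have h : free L = (univ.filter fun k : Fin 10 => k = 0 ∨ k = 1 ∨ k = 4 ∨ k = 5 ∨ k = 8 ∨ k = 9) ×ˢ
      (univ : Finset (Fin L)) := by
    ext ⟨k, i⟩
    simp [free]
  have h6 : (univ.filter fun k : Fin 10 => k = 0 ∨ k = 1 ∨ k = 4 ∨ k = 5 ∨ k = 8 ∨ k = 9).card = 6 := by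
    decide
  rw [h, card_product, h6, card_univ, Fintype.card_fin]

/-- `core` and `free` are disjoint. -/
theorem disjoint_core_free (L : ℕ) : Disjoint (core L) (free L) := by
  rw [Finset.disjoint_left]
  intro v hc hf
  simp only [core, mem_filter, mem_univ, true_and] at hc
  simp only [free, mem_filter, mem_univ, true_and] at hf
  omega

/-- **Every unit is split by `core L ∪ S` whenever `S ⊆ free L`**: the edge `b'ᵢ c'ⱼ` lies inside, the edge
`bᵢ cⱼ` has its `b`-end (block `2`) outside. -/
theorem unit_split_of_subset_free {L : ℕ} {S : Finset (Vx L)} (hS : S ⊆ free L) (u : Fin L × Fin L) :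
    (∃ e ∈ unit L u, ∀ v ∈ e, v ∈ core L ∪ S) ∧ (∃ e ∈ unit L u, ∃ v ∈ e, v ∉ core L ∪ S) := by
  refine ⟨⟨s(vx 3 u.1, vx 7 u.2), by simp [unit], ?_⟩,
    ⟨s(vx 2 u.1, vx 6 u.2), by simp [unit], vx 2 u.1, by simp, ?_⟩⟩
  · intro v hv
    rw [Sym2.mem_iff] at hv
    rcases hv with rfl | rfl <;> simp [core, vx]
  · intro h
    rw [mem_union] at h
    rcases h with h | h
    · simp [core, vx] at h
    · have h' := hS h
      simp [free, vx] at h'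

/-- **Good cuts of every size**: for `2L ≤ b ≤ 8L` some cut of size `b` splits every unit of `𝒯_L`. -/
theorem exists_good_cut {L b : ℕ} (h1 : 2 * L ≤ b) (h2 : b ≤ 8 * L) :
    ∃ B : Finset (Vx L), B.card = b ∧
      ∀ u, (∃ e ∈ unit L u, ∀ v ∈ e, v ∈ B) ∧ (∃ e ∈ unit L u, ∃ v ∈ e, v ∉ B) := by
  obtain ⟨S, hS, hcard⟩ := Finset.exists_subset_card_eq (s := free L) (n := b - 2 * L)
    (by rw [free_card]; omega)
  refine ⟨core L ∪ S, ?_, fun u => unit_split_of_subset_free hS u⟩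
  rw [card_union_of_disjoint ((disjoint_core_free L).mono_right hS), core_card, hcard]
  omega

/-- **Engine bound at a good cut**: every cut rectangle over a cut splitting all units has `mu`-mass
`≤ (1/2)^{L²}` (D2 of `𝒯_L`: `toft_D2`). -/
theorem toft_rect_bound {L : ℕ} (hL : Odd L) (h3 : 3 ≤ L) {B : Finset (Vx L)}
    (hB : ∀ u, (∃ e ∈ unit L u, ∀ v ∈ e, v ∈ B) ∧ (∃ e ∈ unit L u, ∃ v ∈ e, v ∉ B)) :
    ∀ 𝓐 𝓑 : Finset (Finset (Sym2 (Vx L))),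
      (∀ α ∈ 𝓐, ∀ e ∈ α, ¬ e.IsDiag ∧ ∃ v ∈ e, v ∉ B) →
      (∀ β ∈ 𝓑, ∀ e ∈ β, ¬ e.IsDiag ∧ ∀ v ∈ e, v ∈ B) →
      (∀ α ∈ 𝓐, ∀ β ∈ 𝓑,
        ¬ (SimpleGraph.fromEdgeSet ((α ∪ β : Finset (Sym2 (Vx L))) : Set (Sym2 (Vx L)))).Colorable 3) →
      ∑ q ∈ 𝓐 ×ˢ 𝓑, mu (frame L) (unit L) (q.1 ∪ q.2) ≤ (1 / 2 : ℝ) ^ (L * L) := by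
  intro 𝓐 𝓑 h𝓐 h𝓑 hN
  have h := rect_mass_le_half_pow (fun u => unit_card u) (toft_D2 hL h3) (univ : Finset (Fin L × Fin L))
    (fun u _ => hB u) 𝓐 𝓑 h𝓐 h𝓑 hN
  simpa [Finset.card_univ, Fintype.card_prod, Fintype.card_fin] using h

/-! ### Carrying a cut onto a prescribed cut -/

/-- Equinumerous vertex types, equinumerous cuts: some vertex bijection carries the one cut onto the other. -/
theorem exists_equiv_map_eq {V W : Type*} [Fintype V] [DecidableEq V] [Fintype W] [DecidableEq W]
    (hVW : Fintype.card V = Fintype.card W) (B' : Finset V) (B : Finset W) (h : B'.card = B.card) :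
    ∃ e : V ≃ W, B'.map e.toEmbedding = B := by
  classical
  have h1 : Fintype.card {v // v ∈ B'} = Fintype.card {w // w ∈ B} := by
    rw [Fintype.card_coe, Fintype.card_coe, h]
  have h2 : Fintype.card {v // v ∉ B'} = Fintype.card {w // w ∉ B} := by
    rw [Fintype.card_subtype_compl, Fintype.card_subtype_compl, hVW, Fintype.card_coe, Fintype.card_coe, h]
  let e₀ : {v // v ∈ B'} ≃ {w // w ∈ B} := Fintype.equivOfCardEq h1
  let e₁ : {v // v ∉ B'} ≃ {w // w ∉ B} := Fintype.equivOfCardEq h2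
  let e : V ≃ W :=
    (Equiv.sumCompl fun v => v ∈ B').symm.trans ((e₀.sumCongr e₁).trans (Equiv.sumCompl fun w => w ∈ B))
  have he : ∀ v (hv : v ∈ B'), e v = (e₀ ⟨v, hv⟩ : W) := fun v hv => by
    simp only [e, Equiv.trans_apply, Equiv.sumCompl_symm_apply_of_pos hv, Equiv.sumCongr_apply,
      Sum.map_inl, Equiv.sumCompl_apply_inl]
  refine ⟨e, Finset.eq_of_subset_of_card_le (fun w hw => ?_) (by rw [Finset.card_map, h])⟩
  rw [Finset.mem_map] at hw
  obtain ⟨v, hv, rfl⟩ := hw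
  rw [Equiv.coe_toEmbedding, he v hv]
  exact (e₀ ⟨v, hv⟩).2

/-! ### Arithmetic of the exponent (`seven_mul_le_two_pow`, `exponent_le` reused from `AeaCutRectanglesFixedCutFooling`) -/

/-- The final comparison `(1/2)^{L²} ≤ 2^{-(n/2)·log₂ n - C·n}` for `n = 10L`, `L = 2^k + 1`, `k ≥ 10C + 40`. -/
theorem half_pow_sq_le {k C : ℕ} (hkC : 10 * C + 40 ≤ k) (hk6 : 6 ≤ k) :
    ((1 : ℝ) / 2) ^ ((2 ^ k + 1) * (2 ^ k + 1)) ≤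
      (2 : ℝ) ^ (-(((10 * (2 ^ k + 1) : ℕ) : ℝ) / 2 * Real.logb 2 ((10 * (2 ^ k + 1) : ℕ) : ℝ)) -
        (C : ℝ) * ((10 * (2 ^ k + 1) : ℕ) : ℝ)) := by
  set L : ℕ := 2 ^ k + 1 with hL
  have h7 := seven_mul_le_two_pow hk6
  have hLpos : (0 : ℝ) < L := by exact_mod_cast (show 0 < L by omega)
  have h16 : (10 * L : ℝ) ≤ (2 : ℝ) ^ (k + 4) := by
    have h : 10 * L ≤ 2 ^ (k + 4) := by
      rw [pow_add]
      norm_num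
      omega
    exact_mod_cast h
  have hlog : Real.logb 2 (10 * L : ℝ) ≤ k + 4 := by
    have h := Real.logb_le_logb_of_le (b := 2) (by norm_num) (by linarith) h16
    rw [Real.logb_pow, Real.logb_self_eq_one (by norm_num), mul_one] at h
    exact_mod_cast h
  have hcore : 5 * (k + 4 + 2 * C) ≤ L := by omega
  have hexp := exponent_le hlog hcore
  have hcast : ((10 * L : ℕ) : ℝ) = 10 * (L : ℝ) := by push_cast; ring
  rw [hcast]
  calc ((1 : ℝ) / 2) ^ (L * L) = (2 : ℝ) ^ (-((L : ℝ) * L)) := by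
        rw [Real.rpow_neg (by norm_num), ← Nat.cast_mul, Real.rpow_natCast, one_div, inv_pow]
    _ ≤ (2 : ℝ) ^ (-(10 * (L : ℝ) / 2 * Real.logb 2 (10 * (L : ℝ))) - (C : ℝ) * (10 * (L : ℝ))) :=
        Real.rpow_le_rpow_of_exponent_le (by norm_num) (by linarith)

/-! ### The rung: for every near-balanced cut there is a fooling measure -/

/-- **X1 with `∃ μ ∀ B` weakened to `∀ B ∃ μ` (ε = 1/4, the whole window X1 allows).**  For every `C`, for
infinitely many `n` (`n = 10(2^k+1)`, all large `k`): for EVERY cut `B` with `n/4 ≤ |B| ≤ 3n/4` there is a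
probability measure on loopless non-3-colourable edge sets over `Fin n` all of whose cut rectangles over `B` inside
NON-3-COL have mass `≤ 2^{-(n/2)·log₂ n - C·n}`.  (The Toft measure carried so that a cut splitting all `L²`
units lands on `B`.)  What separates this from X1 is only the uniformity of `μ` in `B`. -/
theorem foolingMeasure_everyCut (C : ℕ) : ∃ᶠ n in Filter.atTop, ∀ B : Finset (Fin n),
    (1 / 2 - 1 / 4 : ℝ) * (n : ℝ) ≤ B.card → (B.card : ℝ) ≤ (1 / 2 + 1 / 4) * n →
    ∃ μ : Finset (Sym2 (Fin n)) → ℝ,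
      (∀ S, 0 ≤ μ S) ∧ (∑ S, μ S = 1) ∧
      (∀ S, μ S ≠ 0 → (∀ e ∈ S, ¬ e.IsDiag) ∧
        ¬ (SimpleGraph.fromEdgeSet (S : Set (Sym2 (Fin n)))).Colorable 3) ∧
      ∀ 𝓐 𝓑 : Finset (Finset (Sym2 (Fin n))),
        (∀ α ∈ 𝓐, ∀ e ∈ α, ¬ e.IsDiag ∧ ∃ v ∈ e, v ∉ B) →
        (∀ β ∈ 𝓑, ∀ e ∈ β, ¬ e.IsDiag ∧ ∀ v ∈ e, v ∈ B) →
        (∀ α ∈ 𝓐, ∀ β ∈ 𝓑,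
          ¬ (SimpleGraph.fromEdgeSet ((α ∪ β : Finset (Sym2 (Fin n))) : Set (Sym2 (Fin n)))).Colorable 3) →
        ∑ q ∈ 𝓐 ×ˢ 𝓑, μ (q.1 ∪ q.2) ≤ (2 : ℝ) ^ (-((n : ℝ) / 2 * Real.logb 2 n) - (C : ℝ) * n) := by
  rw [Filter.frequently_atTop]
  intro N
  obtain ⟨k, hkN, hkC, hk6⟩ : ∃ k, N ≤ k ∧ 10 * C + 40 ≤ k ∧ 6 ≤ k :=
    ⟨N + 10 * C + 40, by omega, by omega, by omega⟩
  set L : ℕ := 2 ^ k + 1 with hL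
  have h2k : 2 ≤ 2 ^ k :=
    calc 2 = 2 ^ 1 := by norm_num
      _ ≤ 2 ^ k := Nat.pow_le_pow_right (by norm_num) (by omega)
  have h7 := seven_mul_le_two_pow hk6
  have hLodd : Odd L := by
    rw [hL]
    exact (Nat.even_pow.2 ⟨even_two, by omega⟩).add_one
  have hL3 : 3 ≤ L := by omega
  refine ⟨10 * L, by omega, ?_⟩
  intro B hB1 hB2
  -- the size of `B` lies in `[2L, 8L]`
  have hb1 : 2 * L ≤ B.card := by
    have h : (2 * L : ℝ) ≤ B.card := by push_cast at hB1 ⊢; nlinarith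
    exact_mod_cast h
  have hb2 : B.card ≤ 8 * L := by
    have h : (B.card : ℝ) ≤ 8 * L := by push_cast at hB2 ⊢; nlinarith
    exact_mod_cast h
  -- a cut of `𝒯_L` of the same size splitting every unit, and a bijection carrying it onto `B`
  obtain ⟨B', hB'card, hB'split⟩ := exists_good_cut hb1 hb2
  obtain ⟨e, he⟩ := exists_equiv_map_eq (V := Vx L) (W := Fin (10 * L)) (by simp) B' B hB'card
  -- transport the Toft package
  obtain ⟨h0, h1, hs, -, -⟩ := toft_fooling hLodd hL3
  obtain ⟨μ', h0', h1', hs', hr'⟩ :=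
    transport e (mu (frame L) (unit L)) B' ((1 / 2 : ℝ) ^ (L * L)) h0 h1 hs (toft_rect_bound hLodd hL3 hB'split)
  rw [he] at hr'
  refine ⟨μ', h0', h1', hs', fun 𝓐 𝓑 h𝓐 h𝓑 hN => (hr' 𝓐 𝓑 h𝓐 h𝓑 hN).trans ?_⟩
  exact half_pow_sq_le hkC hk6

/-- **The same rung in X1's binder shape**: X1 reads `∃ ε ∀ C ∃ᶠ n ∃ μ ∀ B …`; here `∃ μ` and `∀ B` are swapped
(and nothing else changes). -/
theorem foolingMeasure_forall_cut_exists_measure :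
    ∃ ε : ℝ, 0 < ε ∧ ε ≤ 1 / 4 ∧ ∀ C : ℕ, ∃ᶠ n in Filter.atTop, ∀ B : Finset (Fin n),
      (1 / 2 - ε) * (n : ℝ) ≤ B.card → (B.card : ℝ) ≤ (1 / 2 + ε) * n →
      ∃ μ : Finset (Sym2 (Fin n)) → ℝ,
        (∀ S, 0 ≤ μ S) ∧ (∑ S, μ S = 1) ∧
        (∀ S, μ S ≠ 0 → (∀ e ∈ S, ¬ e.IsDiag) ∧
          ¬ (SimpleGraph.fromEdgeSet (S : Set (Sym2 (Fin n)))).Colorable 3) ∧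
        ∀ 𝓐 𝓑 : Finset (Finset (Sym2 (Fin n))),
          (∀ α ∈ 𝓐, ∀ e ∈ α, ¬ e.IsDiag ∧ ∃ v ∈ e, v ∉ B) →
          (∀ β ∈ 𝓑, ∀ e ∈ β, ¬ e.IsDiag ∧ ∀ v ∈ e, v ∈ B) →
          (∀ α ∈ 𝓐, ∀ β ∈ 𝓑,
            ¬ (SimpleGraph.fromEdgeSet ((α ∪ β : Finset (Sym2 (Fin n))) : Set (Sym2 (Fin n)))).Colorable 3) →
          ∑ q ∈ 𝓐 ×ˢ 𝓑, μ (q.1 ∪ q.2) ≤ (2 : ℝ) ^ (-((n : ℝ) / 2 * Real.logb 2 n) - (C : ℝ) * n) :=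
  ⟨1 / 4, by norm_num, le_rfl, fun C => foolingMeasure_everyCut C⟩

end Summit.PneNP.PneNP.Theorems.AeaCutRectanglesEveryCutFooling
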